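import Summits.Ventures.CertifiedManyBodySolver.Observables.PairLROTowerStationaryStep
import HarnessLib

/-!
# OP1-C, part 1: the finite-volume tower step with a CHARGED equation-of-motion slack against the global
# grand-canonical floor

HONEST FRAMING: first certified bounds on pairing observables; not a superconductivity verdict; a ceiling
route, never presence. Crew hubbard-obs (D-0042), seat hubbard-obs-p1 (`prover-hubbard-obs-p1-g8-0`), on the
soundness claim of sr-mbsolver-menu-3 (MENU3-TLPINCER.md §7.4, hubbard-obs STATUS (eg1) 2026-08-26). Zero
compute; no definition; no named fact; no `sorry`.

`tower_finite_step_S` (PairLROTowerStationaryStep) lets the one-point bound (OP1) carry the slack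
`Re⟨ζ,(HW − WH)ζ⟩/L²` of a NUMBER-CONSERVING `W` (neutral equation-of-motion rows), controlled level by level
by finite-volume Pusz–Woronowicz against the floors of the particle-number SECTORS. Here `W = B₁ + iB₂` is
ARBITRARY (charged words allowed: pair words, the rows `ω([H − μN̂, X]) = 0` of the bootstrap at chemical
potential `μ`), the slack is `Re⟨ζ,(K W − W K)ζ⟩/L²` with `K = H_L − μc·N̂`, and Pusz–Woronowicz
(`norm_expect_commutator_le_sqrt_add_sqrt` with the trivial charge `Q = 1`) is applied ONCE, to the tower
witness itself, against a GLOBAL lower bound `Efl ≤ Re⟨χ,Kχ⟩` valid for every unit vector of the Fock space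
(hypothesis `hKfl`; supplied with an explicit `O(L)` rate at a supporting slope `μc ∈ [μ₋(n), μ₊(n)]` by
`ThermodynamicLimit.sub_mul_sq_le_re_expect_sub_mul_totalNumber`, HubbardNNNHoppingGrandCanonicalFloor). The
excess budget `ε ≥ E_N + D̄_k − μc(N + k) − Efl` (hypothesis `hε`; the witness has `Re⟨Ξ,HΞ⟩ ≤ E_N + D̄_k` and
`⟨Ξ,N̂Ξ⟩ = N + k` exactly) enters the conclusion as `(√(2εD₁) + √(2εD₂))/L`; along a density-`n` ground-state
family `ε = o(L²)` (Fenchel–Young equality at the supporting slope) so the slack vanishes — part 2 (the family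
theorem `liminf_pairFieldLRO_le_sq_of_onePoint_chargedStationary_bound_TT'`, to follow) closes exactly as the
neutral case. No sector convexity, no equivalence of ensembles at finite `L`.

* `tower_finite_step_C` — one torus, abstract `W = B₁ + iB₂`, chemical potential `μc`, global `K`-floor.

References: T. Koma, H. Tasaki, J. Stat. Phys. 76 (1994) 745, Theorem 5, §4 [KomaTasaki1994]; W. Pusz,
S. L. Woronowicz, Comm. Math. Phys. 58 (1978) 273, §1 [PuszWoronowicz1978]; X. Han, arXiv:2006.06002,
§2–3 (equation-of-motion constraints) [Han2020Bootstrap]; M. Araújo et al., arXiv:2311.18707 (state-optimality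
/ KKT rows) [AraujoEtAl2023].
-/

noncomputable section

namespace Summit.Ventures.CertifiedManyBodySolver.Observables

open Matrix Complex Finset Literature.MathematicalPhysics.QuantumLattice Literature.Probability.LatticeModels
open Literature.MathematicalPhysics.QuantumLattice.HubbardWave0 ThermodynamicLimit Filter Topology
open Literature.MathematicalPhysics.QuantumManyBody.StateRelaxation
open scoped ComplexOrder ComplexConjugate BigOperators

/-! ### §1  One torus: the tower step with a charged equation-of-motion slack -/

section Finite

variable {L : ℕ} [NeZero L] (g : Site 2 → ℝ)

/-- **The finite-volume tower step with a CHARGED eom slack.** Data of `tower_finite_step` (unit sector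
ground state `ψ` of `H = hubbardTorusTT' L t t' U` in `(N, S^z = 0)`, LRO floor `c₀L⁴ ≤ Re⟨ψ,Δ†Δψ⟩`, constants
`Cα, Cκ, Cγ`, `(k+1)Cγ ≤ (c₀/2)L²`, `κ ≥ 0`), PLUS: a chemical potential `μc`, an ARBITRARY operator
`W = B₁ + iB₂` (`B₁, B₂` Hermitian), double-commutator bounds `|Re⟨χ,[B_i,[B_i,K]]χ⟩| ≤ D_i·L²` on unit `χ`
for `K = H − μc N̂`, a GLOBAL floor `Efl ≤ Re⟨χ,Kχ⟩` on the unit vectors of the whole Fock space, and an excess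
budget `ε ≥ E + D̄ − μc(N + k) − Efl` (`E = minEnergyOn (szSector N 0)`, `D̄ = (Cκ/√(c₀/2))Σ_{i<k}(Cα/√(c₀/2))^i`).
If the one-point bound (OP1-C) — (OP1) with the extra term `Re⟨ζ,(KW − WK)ζ⟩/L²` on the left — holds for
every unit `ζ`, then
`(k/(k+1))√(c₀ − (k+1)Cγ/L²) ≤ −(c − A + (Σμ)((N/2)/L² − ν) + κ(u − E/L²)) + K₀/L² + (√(2εD₁) + √(2εD₂))/L`,
`K₀` as in `tower_finite_step`. [cite: KomaTasaki1994, Theorem 5 and §4] [cite: PuszWoronowicz1978, §1]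
[cite: Han2020Bootstrap, §2] -/
theorem tower_finite_step_C (t t' U μc : ℝ) {N : ℕ} {ψ : Fock (Orb (FermionTorus 2 L))}
    (hψ1 : star ψ ⬝ᵥ ψ = 1) (hgs : IsGroundStateInSector (hubbardTorusTT' L t t' U) N 0 ψ)
    {c A κ u ν c₀ Cα Cκ Cγ : ℝ} (μ : Fin 2 → ℝ) (hκ : 0 ≤ κ) (hc₀ : 0 < c₀) (hCα : 0 ≤ Cα) (hCκ : 0 ≤ Cκ)
    (hCγ : 0 ≤ Cγ) (k : ℕ)
    (hα : ∀ φ : Fock (Orb (FermionTorus 2 L)),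
      eucNorm ((pairField g L)ᴴ *ᵥ φ) ≤ Cα * (L : ℝ) ^ 2 * eucNorm φ)
    (hκ' : ∀ φ : Fock (Orb (FermionTorus 2 L)),
      eucNorm ((hubbardTorusTT' L t t' U * (pairField g L)ᴴ - (pairField g L)ᴴ * hubbardTorusTT' L t t' U) *ᵥ φ) ≤
        Cκ * (L : ℝ) ^ 2 * eucNorm φ)
    (hγ : ∀ φ : Fock (Orb (FermionTorus 2 L)), star φ ⬝ᵥ φ = 1 →
      |(expect (pairField g L * (pairField g L)ᴴ - (pairField g L)ᴴ * pairField g L) φ).re| ≤ Cγ * (L : ℝ) ^ 2)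
    (hlro : c₀ * (L : ℝ) ^ 4 ≤ (expect ((pairField g L)ᴴ * pairField g L) ψ).re)
    (hLbig : (k + 1) * Cγ ≤ (c₀ / 2) * (L : ℝ) ^ 2)
    -- the equation-of-motion operator
    (W B₁ B₂ : Matrix (Finset (Orb (FermionTorus 2 L))) (Finset (Orb (FermionTorus 2 L))) ℂ)
    (hB₁ : B₁.IsHermitian) (hB₂ : B₂.IsHermitian) (hWB : W = B₁ + (I : ℂ) • B₂) {D₁ D₂ Efl ε : ℝ}
    (hD₁ : 0 ≤ D₁) (hD₂ : 0 ≤ D₂)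
    (hDD₁ : ∀ χ : Fock (Orb (FermionTorus 2 L)), star χ ⬝ᵥ χ = 1 →
      |(star χ ⬝ᵥ ((B₁ * (B₁ * (hubbardTorusTT' L t t' U - (μc : ℂ) • totalNumber) -
          (hubbardTorusTT' L t t' U - (μc : ℂ) • totalNumber) * B₁) -
        (B₁ * (hubbardTorusTT' L t t' U - (μc : ℂ) • totalNumber) -
          (hubbardTorusTT' L t t' U - (μc : ℂ) • totalNumber) * B₁) * B₁) *ᵥ χ)).re| ≤ D₁ * (L : ℝ) ^ 2)
    (hDD₂ : ∀ χ : Fock (Orb (FermionTorus 2 L)), star χ ⬝ᵥ χ = 1 →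
      |(star χ ⬝ᵥ ((B₂ * (B₂ * (hubbardTorusTT' L t t' U - (μc : ℂ) • totalNumber) -
          (hubbardTorusTT' L t t' U - (μc : ℂ) • totalNumber) * B₂) -
        (B₂ * (hubbardTorusTT' L t t' U - (μc : ℂ) • totalNumber) -
          (hubbardTorusTT' L t t' U - (μc : ℂ) • totalNumber) * B₂) * B₂) *ᵥ χ)).re| ≤ D₂ * (L : ℝ) ^ 2)
    -- the GLOBAL floor of `K = H − μc N̂` on the Fock space, and the excess budget `ε`
    (hKfl : ∀ χ : Fock (Orb (FermionTorus 2 L)), star χ ⬝ᵥ χ = 1 →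
      Efl ≤ (star χ ⬝ᵥ ((hubbardTorusTT' L t t' U - (μc : ℂ) • totalNumber) *ᵥ χ)).re)
    (hε : (hubbardTorusTT' L t t' U).minEnergyOn (szSector N 0) +
        (Cκ / Real.sqrt (c₀ / 2)) * ∑ i ∈ Finset.range k, (Cα / Real.sqrt (c₀ / 2)) ^ i -
        μc * ((N : ℝ) + k) - Efl ≤ ε)
    (hboundC : ∀ ζ : Fock (Orb (FermionTorus 2 L)), star ζ ⬝ᵥ ζ = 1 →
      c - A + ∑ σ : Fin 2, μ σ *
          ((star ζ ⬝ᵥ ((∑ y : FermionTorus 2 L, numberOp y σ) *ᵥ ζ)).re / (L : ℝ) ^ 2 - ν) +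
        κ * (u - (star ζ ⬝ᵥ (hubbardTorusTT' L t t' U *ᵥ ζ)).re / (L : ℝ) ^ 2) +
        (star ζ ⬝ᵥ (((hubbardTorusTT' L t t' U - (μc : ℂ) • totalNumber) * W -
            W * (hubbardTorusTT' L t t' U - (μc : ℂ) • totalNumber)) *ᵥ ζ)).re / (L : ℝ) ^ 2 ≤
        -((expect (pairField g L) ζ).re / (L : ℝ) ^ 2)) :
    (k : ℝ) / (k + 1) * Real.sqrt (c₀ - (k + 1) * Cγ / (L : ℝ) ^ 2) ≤
      -(c - A + (∑ σ : Fin 2, μ σ) * (((N : ℝ) / 2) / (L : ℝ) ^ 2 - ν) +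
          κ * (u - (hubbardTorusTT' L t t' U).minEnergyOn (szSector N 0) / (L : ℝ) ^ 2)) +
        (-(∑ σ : Fin 2, μ σ) * k / 2 +
          κ * ((Cκ / Real.sqrt (c₀ / 2)) * ∑ i ∈ Finset.range k, (Cα / Real.sqrt (c₀ / 2)) ^ i)) / (L : ℝ) ^ 2 +
        (Real.sqrt (2 * ε * D₁) + Real.sqrt (2 * ε * D₂)) / (L : ℝ) := by
  set H := hubbardTorusTT' L t t' U with hH
  set P := pairField g L with hP
  set E : ℝ := H.minEnergyOn (szSector N 0) with hE
  have hHherm : H.IsHermitian := hubbardTorusTT'_isHermitian L t t' U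
  have hL : (0 : ℝ) < (L : ℝ) := Nat.cast_pos.2 (Nat.pos_of_ne_zero (NeZero.ne L))
  have hL2 : (0 : ℝ) < (L : ℝ) ^ 2 := by positivity
  have hHN : H * totalNumber = totalNumber * H := (hubbardTorusTT'_commute_totalNumber L t t' U).eq
  have hNA : (totalNumber : Matrix _ _ ℂ) * Pᴴ - Pᴴ * totalNumber = ((2 : ℝ) : ℂ) • Pᴴ := by
    have h := commutator_conjTranspose_of_commutator totalNumber_isHermitian (totalNumber_commutator_pairField g L)
    rw [neg_neg] at h; exact h
  have hHψ : H *ᵥ ψ = (E : ℂ) • ψ := hgs.2.2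
  have hNψ : (totalNumber : Matrix _ _ ℂ) *ᵥ ψ = ((N : ℝ) : ℂ) • ψ := by
    rw [totalNumber_mulVec_of_isNParticle ((mem_szSector_iff _ _ ψ).1 hgs.1).1]; push_cast; rfl
  set α : ℝ := Cα * (L : ℝ) ^ 2 with hαdef
  set κ₁ : ℝ := Cκ * (L : ℝ) ^ 2 with hκ₁def
  set β : ℝ := Cγ * (L : ℝ) ^ 2 with hβdef
  have hβ' : ∀ φ : Fock (Orb (FermionTorus 2 L)),
      |(star φ ⬝ᵥ ((Pᴴ * Pᴴᴴ - Pᴴᴴ * Pᴴ) *ᵥ φ)).re| ≤ β * eucNorm φ ^ 2 := by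
    intro φ
    rw [conjTranspose_conjTranspose]
    have hunit : ∀ ψ' : Fock (Orb (FermionTorus 2 L)), star ψ' ⬝ᵥ ψ' = 1 →
        |(star ψ' ⬝ᵥ ((Pᴴ * P - P * Pᴴ) *ᵥ ψ')).re| ≤ β := by
      intro ψ' h1
      have h := hγ ψ' h1
      have e : (Pᴴ * P - P * Pᴴ) = -(P * Pᴴ - Pᴴ * P) := by abel
      rw [e, neg_mulVec, dotProduct_neg, Complex.neg_re, abs_neg]
      exact h
    exact abs_re_quadForm_le_of_unit hunit φ
  set ρ : ℝ := (L : ℝ) ^ 2 * Real.sqrt (c₀ - (k + 1) * Cγ / (L : ℝ) ^ 2) with hρdef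
  have hinside : c₀ / 2 ≤ c₀ - (k + 1) * Cγ / (L : ℝ) ^ 2 := by
    have h1 : (k + 1) * Cγ / (L : ℝ) ^ 2 ≤ c₀ / 2 := by
      rw [div_le_iff₀ hL2]; exact hLbig
    linarith
  have hρpos : 0 < ρ := by
    have : 0 < Real.sqrt (c₀ - (k + 1) * Cγ / (L : ℝ) ^ 2) := Real.sqrt_pos.2 (by linarith)
    positivity
  have hρ2 : ρ ^ 2 + k * β ≤ eucNorm (Pᴴ *ᵥ ψ) ^ 2 := by
    have e1 : eucNorm (Pᴴ *ᵥ ψ) ^ 2 = (expect (P * Pᴴ) ψ).re := by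
      rw [eucNorm_sq, star_mulVec, conjTranspose_conjTranspose, ← dotProduct_mulVec, mulVec_mulVec]; rfl
    have e2 : ρ ^ 2 = c₀ * (L : ℝ) ^ 4 - (k + 1) * Cγ * (L : ℝ) ^ 2 := by
      rw [hρdef, mul_pow, Real.sq_sqrt (by linarith), mul_sub, mul_div_assoc']
      have hx : ((L : ℝ) ^ 2) ^ 2 * ((k + 1) * Cγ) / (L : ℝ) ^ 2 = (L : ℝ) ^ 2 * ((k + 1) * Cγ) := by
        rw [pow_two ((L : ℝ) ^ 2), mul_assoc, mul_div_assoc, mul_div_cancel_left₀ _ hL2.ne']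
      rw [hx]
      ring
    have h3 : (expect (Pᴴ * P) ψ).re - Cγ * (L : ℝ) ^ 2 ≤ (expect (P * Pᴴ) ψ).re := by
      have h := (abs_le.1 (hγ ψ hψ1)).1
      have e : expect (P * Pᴴ - Pᴴ * P) ψ = expect (P * Pᴴ) ψ - expect (Pᴴ * P) ψ := by
        simp [Literature.MathematicalPhysics.QuantumLattice.expect, sub_mulVec, dotProduct_sub]
      rw [e, Complex.sub_re] at h
      linarith
    rw [e1, e2, hβdef]
    nlinarith [hlro, h3]
  obtain ⟨Ξ, hΞ1, -, hΞP, hΞH, hΞG, hΞC⟩ := exists_towerWitness_comm totalNumber_isHermitian hHN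
    (by norm_num : (2 : ℝ) ≠ 0) hNA hψ1 hHψ hNψ (by positivity : 0 ≤ α) hα (by positivity : 0 ≤ κ₁) hκ'
    (by positivity : 0 ≤ β) hβ' k hρpos hρ2
  rw [conjTranspose_conjTranspose] at hΞP
  have hΞN : ∀ σ : Fin 2, (star Ξ ⬝ᵥ ((∑ y : FermionTorus 2 L, numberOp y σ) *ᵥ Ξ)).re = (N : ℝ) / 2 + k / 2 := by
    intro σ
    have hGA : (∑ y : FermionTorus 2 L, numberOp y σ) * Pᴴ - Pᴴ * (∑ y : FermionTorus 2 L, numberOp y σ) =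
        ((1 : ℝ) : ℂ) • Pᴴ := by
      have h := commutator_conjTranspose_of_commutator (spinNumber_isHermitian (L := L) σ)
        (spinNumber_commutator_pairField g σ)
      rw [neg_neg] at h; exact h
    have hGψ := spinNumber_mulVec_of_mem_szSector σ hgs.1
    rw [hΞG _ 1 ((N : ℝ) / 2) hGA hGψ, Complex.ofReal_re]
    ring
  have hwin := hboundC Ξ hΞ1
  simp_rw [hΞN] at hwin
  have hfill : ∑ σ : Fin 2, μ σ * (((N : ℝ) / 2 + k / 2) / (L : ℝ) ^ 2 - ν) =
      (∑ σ : Fin 2, μ σ) * (((N : ℝ) / 2) / (L : ℝ) ^ 2 - ν) + (∑ σ : Fin 2, μ σ) * (k / 2) / (L : ℝ) ^ 2 := by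
    rw [Finset.sum_mul, Finset.sum_mul, Finset.sum_div, ← Finset.sum_add_distrib]
    refine Finset.sum_congr rfl fun σ _ => ?_
    ring
  rw [hfill] at hwin
  set Dbar : ℝ := (Cκ / Real.sqrt (c₀ / 2)) * ∑ i ∈ Finset.range k, (Cα / Real.sqrt (c₀ / 2)) ^ i with hDbar
  have hsqrt_le : (L : ℝ) ^ 2 * Real.sqrt (c₀ / 2) ≤ ρ := by
    rw [hρdef]
    exact mul_le_mul_of_nonneg_left (Real.sqrt_le_sqrt hinside) hL2.le
  have hs0 : 0 < Real.sqrt (c₀ / 2) := Real.sqrt_pos.2 (by linarith)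
  have hratio1 : κ₁ / ρ ≤ Cκ / Real.sqrt (c₀ / 2) := by
    rw [hκ₁def, div_le_div_iff₀ hρpos hs0]
    calc Cκ * (L : ℝ) ^ 2 * Real.sqrt (c₀ / 2) = Cκ * ((L : ℝ) ^ 2 * Real.sqrt (c₀ / 2)) := by ring
      _ ≤ Cκ * ρ := mul_le_mul_of_nonneg_left hsqrt_le hCκ
  have hratio2 : α / ρ ≤ Cα / Real.sqrt (c₀ / 2) := by
    rw [hαdef, div_le_div_iff₀ hρpos hs0]
    calc Cα * (L : ℝ) ^ 2 * Real.sqrt (c₀ / 2) = Cα * ((L : ℝ) ^ 2 * Real.sqrt (c₀ / 2)) := by ring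
      _ ≤ Cα * ρ := mul_le_mul_of_nonneg_left hsqrt_le hCα
  have hD_le : (κ₁ / ρ) * ∑ i ∈ Finset.range k, (α / ρ) ^ i ≤ Dbar := by
    rw [hDbar]
    refine mul_le_mul hratio1 (Finset.sum_le_sum fun i _ => ?_) (Finset.sum_nonneg fun i _ => by positivity)
      (div_nonneg hCκ hs0.le)
    exact pow_le_pow_left₀ (by positivity) hratio2 i
  have hDbar0 : 0 ≤ Dbar := by
    rw [hDbar]
    exact mul_nonneg (div_nonneg hCκ hs0.le) (Finset.sum_nonneg fun i _ => by positivity)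
  have heΞ : (star Ξ ⬝ᵥ (H *ᵥ Ξ)).re ≤ E + Dbar := hΞH.trans (by linarith)
  ---------------------------------------------------------------- the charged equation-of-motion slack
  set K := H - (μc : ℂ) • (totalNumber : Matrix (Finset (Orb (FermionTorus 2 L))) (Finset (Orb (FermionTorus 2 L))) ℂ)
    with hK
  have hKherm : K.IsHermitian := by
    rw [hK]
    refine hHherm.sub ?_
    rw [Matrix.IsHermitian, conjTranspose_smul, totalNumber_isHermitian.eq, Complex.star_def, Complex.conj_ofReal]
  -- the `K`-energy of the witness: `Re⟨Ξ,HΞ⟩ ≤ E + Dbar`, `⟨Ξ,N̂Ξ⟩ = N + k`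
  have hΞNum : star Ξ ⬝ᵥ (totalNumber *ᵥ Ξ) = (((N : ℝ) + 2 * k / 2 : ℝ) : ℂ) := hΞG totalNumber 2 (N : ℝ) hNA hNψ
  have hΞK : (star Ξ ⬝ᵥ (K *ᵥ Ξ)).re ≤ Efl + ε := by
    have e : star Ξ ⬝ᵥ (K *ᵥ Ξ) = star Ξ ⬝ᵥ (H *ᵥ Ξ) - (μc : ℂ) * (star Ξ ⬝ᵥ (totalNumber *ᵥ Ξ)) := by
      rw [hK, sub_mulVec, smul_mulVec, dotProduct_sub, dotProduct_smul, smul_eq_mul]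
    rw [e, hΞNum, Complex.sub_re, ← Complex.ofReal_mul, Complex.ofReal_re]
    have e2 : μc * ((N : ℝ) + 2 * k / 2) = μc * ((N : ℝ) + k) := by ring
    rw [e2]
    linarith [heΞ, hε]
  have hε0 : 0 ≤ ε := by linarith [hKfl Ξ hΞ1, hΞK]
  set δ : ℝ := Real.sqrt (2 * ε * (D₁ * (L : ℝ) ^ 2)) + Real.sqrt (2 * ε * (D₂ * (L : ℝ) ^ 2)) with hδ
  have hone1 : (1 : Matrix (Finset (Orb (FermionTorus 2 L))) (Finset (Orb (FermionTorus 2 L))) ℂ) *ᵥ Ξ =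
      (1 : ℂ) • Ξ := by rw [one_mulVec, one_smul]
  have heomK : ‖star Ξ ⬝ᵥ ((K * W - W * K) *ᵥ Ξ)‖ ≤ δ :=
    norm_expect_commutator_le_sqrt_add_sqrt hKherm hB₁ hB₂ (Commute.one_right B₁) (Commute.one_right B₂) hWB
      hΞ1 hone1 (by positivity : 0 ≤ D₁ * (L : ℝ) ^ 2) (by positivity : 0 ≤ D₂ * (L : ℝ) ^ 2)
      (fun χ hχ1 _ => hKfl χ hχ1) hΞK hDD₁ hDD₂
  have heom : |(star Ξ ⬝ᵥ ((K * W - W * K) *ᵥ Ξ)).re| ≤ δ := (Complex.abs_re_le_norm _).trans heomK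
  have heom' : -(δ / (L : ℝ) ^ 2) ≤ (star Ξ ⬝ᵥ ((K * W - W * K) *ᵥ Ξ)).re / (L : ℝ) ^ 2 := by
    rw [← neg_div]
    exact div_le_div_of_nonneg_right (abs_le.1 heom).1 hL2.le
  have hδL : δ / (L : ℝ) ^ 2 = (Real.sqrt (2 * ε * D₁) + Real.sqrt (2 * ε * D₂)) / (L : ℝ) := by
    have e1 : Real.sqrt (2 * ε * (D₁ * (L : ℝ) ^ 2)) = Real.sqrt (2 * ε * D₁) * (L : ℝ) := by
      rw [show 2 * ε * (D₁ * (L : ℝ) ^ 2) = (2 * ε * D₁) * (L : ℝ) ^ 2 by ring,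
        Real.sqrt_mul (mul_nonneg (mul_nonneg zero_le_two hε0) hD₁), Real.sqrt_sq hL.le]
    have e2 : Real.sqrt (2 * ε * (D₂ * (L : ℝ) ^ 2)) = Real.sqrt (2 * ε * D₂) * (L : ℝ) := by
      rw [show 2 * ε * (D₂ * (L : ℝ) ^ 2) = (2 * ε * D₂) * (L : ℝ) ^ 2 by ring,
        Real.sqrt_mul (mul_nonneg (mul_nonneg zero_le_two hε0) hD₂), Real.sqrt_sq hL.le]
    rw [hδ, e1, e2, ← add_mul, div_eq_div_iff hL2.ne' hL.ne']
    ring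
  ---------------------------------------------------------------- assembling
  have hone : (k : ℝ) / (k + 1) * ρ ≤ (expect P Ξ).re := hΞP
  have hρL : ρ / (L : ℝ) ^ 2 = Real.sqrt (c₀ - (k + 1) * Cγ / (L : ℝ) ^ 2) := by
    rw [hρdef, mul_div_cancel_left₀ _ hL2.ne']
  have hen : κ * (u - E / (L : ℝ) ^ 2) - κ * Dbar / (L : ℝ) ^ 2 ≤
      κ * (u - (star Ξ ⬝ᵥ (H *ᵥ Ξ)).re / (L : ℝ) ^ 2) := by
    have h1 : (star Ξ ⬝ᵥ (H *ᵥ Ξ)).re / (L : ℝ) ^ 2 ≤ E / (L : ℝ) ^ 2 + Dbar / (L : ℝ) ^ 2 := by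
      rw [← add_div]; exact div_le_div_of_nonneg_right heΞ hL2.le
    have h2 := mul_le_mul_of_nonneg_left h1 hκ
    rw [mul_add] at h2
    have e : κ * Dbar / (L : ℝ) ^ 2 = κ * (Dbar / (L : ℝ) ^ 2) := by ring
    rw [e]
    linarith
  have hop : (k : ℝ) / (k + 1) * Real.sqrt (c₀ - (k + 1) * Cγ / (L : ℝ) ^ 2) ≤ (expect P Ξ).re / (L : ℝ) ^ 2 := by
    rw [← hρL, ← mul_div_assoc]
    exact div_le_div_of_nonneg_right hone hL2.le
  have e3 : (-(∑ σ : Fin 2, μ σ) * k / 2 + κ * Dbar) / (L : ℝ) ^ 2 =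
      -((∑ σ : Fin 2, μ σ) * (k / 2) / (L : ℝ) ^ 2) + κ * Dbar / (L : ℝ) ^ 2 := by
    ring
  rw [e3, ← hδL]
  linarith [hwin, hen, hop, heom']

end Finite

/-! ### §2  The charged eom operator: Hermitian splitting of a translation sum (no number conservation) -/

section EomOperator

variable {L : ℕ} [NeZero L] {Λw : Finset (Site 2)}

/-- A translation sum of a Hermitian operator is Hermitian. [folklore] -/
private theorem isHermitian_sum_relabel_translate'
    {X : Matrix (Finset (Orb (FermionTorus 2 L))) (Finset (Orb (FermionTorus 2 L))) ℂ}
    (hX : X.IsHermitian) : (∑ v : TorusSite 2 L, relabel (Orb.translate v) X).IsHermitian := by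
  unfold Matrix.IsHermitian
  rw [conjTranspose_sum]
  refine Finset.sum_congr rfl fun v _ => ?_
  rw [← relabel_conjTranspose, hX.eq]

/-- **The charged eom operator splits into Hermitian parts.** For ANY local `w ∈ 𝔄_{Λ_w}` the translation
sum `W = Σ_v T_v Γ_L(w)` is `B₁ + iB₂` with `B₁ = Σ_v T_v Γ_L(½(w + wᴴ))`, `B₂ = Σ_v T_v Γ_L((i/2)(wᴴ − w))`
Hermitian (the number-conservation clauses of `eom_translationSum_decomposition` dropped).
[cite: Han2020Bootstrap, §2] -/
theorem eom_translationSum_decomposition_charged (h : Set.InjOn (Torus.proj (d := 2) L) ↑Λw)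
    (wloc : FermionOp Λw) :
    (∑ v : TorusSite 2 L, relabel (Orb.translate v)
        (fermionEmbed (PolySite.toTorusEmb L h) (((1 / 2 : ℂ)) • (wloc + wlocᴴ)))).IsHermitian ∧
    (∑ v : TorusSite 2 L, relabel (Orb.translate v)
        (fermionEmbed (PolySite.toTorusEmb L h) ((I / 2 : ℂ) • (wlocᴴ - wloc)))).IsHermitian ∧
    (∑ v : TorusSite 2 L, relabel (Orb.translate v) (fermionEmbed (PolySite.toTorusEmb L h) wloc)) =
      (∑ v : TorusSite 2 L, relabel (Orb.translate v)
        (fermionEmbed (PolySite.toTorusEmb L h) (((1 / 2 : ℂ)) • (wloc + wlocᴴ)))) +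
      (I : ℂ) • (∑ v : TorusSite 2 L, relabel (Orb.translate v)
        (fermionEmbed (PolySite.toTorusEmb L h) ((I / 2 : ℂ) • (wlocᴴ - wloc)))) := by
  set Γ := fermionEmbed (PolySite.toTorusEmb L h) with hΓ
  set O₁ : FermionOp Λw := (1 / 2 : ℂ) • (wloc + wlocᴴ) with hO₁
  set O₂ : FermionOp Λw := (I / 2 : ℂ) • (wlocᴴ - wloc) with hO₂
  have hO₁h : O₁.IsHermitian := by
    unfold Matrix.IsHermitian
    rw [hO₁, conjTranspose_smul, conjTranspose_add, conjTranspose_conjTranspose, add_comm]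
    congr 1
    simp
  have hO₂h : O₂.IsHermitian := by
    unfold Matrix.IsHermitian
    rw [hO₂, conjTranspose_smul, conjTranspose_sub, conjTranspose_conjTranspose]
    have hs : star (I / 2 : ℂ) = -(I / 2) := by
      simp [div_eq_mul_inv]
    rw [hs, neg_smul, ← smul_neg, neg_sub]
  have hΓh : ∀ {O : FermionOp Λw}, O.IsHermitian → (Γ O).IsHermitian := by
    intro O hO
    unfold Matrix.IsHermitian
    rw [hΓ, ← fermionEmbed_conjTranspose, hO.eq]
  refine ⟨isHermitian_sum_relabel_translate' (hΓh hO₁h), isHermitian_sum_relabel_translate' (hΓh hO₂h), ?_⟩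
  have hw : wloc = O₁ + (I : ℂ) • O₂ := by
    rw [hO₁, hO₂, smul_smul, smul_add, smul_sub]
    have hI : I * (I / 2) = -(1 / 2 : ℂ) := by
      rw [mul_div_assoc', I_mul_I, neg_div]
    rw [hI, neg_smul, neg_smul, sub_eq_add_neg, neg_neg]
    module
  conv_lhs => rw [hw]
  rw [Finset.smul_sum, ← Finset.sum_add_distrib]
  refine Finset.sum_congr rfl fun v _ => ?_
  rw [fermionEmbed_add, relabel_add, fermionEmbed_smul _ I, relabel_smul]

end EomOperator

end Summit.Ventures.CertifiedManyBodySolver.Observables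

end
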